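import Summits.QuantumAdvantage.QuantumAdvantage.Theorems.SosSandwichPseudoBoundedAAFixedOrder
import Summits.QuantumAdvantage.QuantumAdvantage.Theorems.SosSandwichPseudoBoundedClosure
import Literature.Computability.QuantumComplexity.InfluenceBounds
import Literature.Barriers.QuantumAdvantage.UncorrectedNoiseFourier
import Literature.Analysis.Approximation.MarkovInequality
import Literature.Computability.QuantumComplexity.PolynomialMethod
import HarnessLib

/-!
# Route `SosSandwich`, crux `PseudoBoundedAA` (stmt-QuantumAdvantage-15237): the LEVEL-ONE RUNG of the AA ladder

The crux `PseudoBoundedAA` (PB-AA) asks, for every `p ∈ K_T` (pseudo-bounded of order `T`: `p` and `1 - p` sums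
of squares of polynomials of total degree `≤ T` on the cube) with `Var[p] ≥ ε > 0`, for a variable with
`Inf_i[p] ≥ C (ε/T)^c`; the line card predicts the sharp exponents `(c, exponent of T) = (2, 2)`.  The tree
holds DEGREE-FREE rungs at the TOP of the Walsh–Fourier ladder on `Q_T` (levels `2T`, `2T - 1`:
`Theorems/SosSandwichQueryHomogeneousRung*.lean`, `…QuerySecondLevel*.lean`).  This file proves the rung at the
BOTTOM, level `1`, for EVERY bounded function of Fourier degree `≤ d` on the cube (so on all of `K_T`, `d = 2T`,
and on `Q_T`), with exactly the predicted exponents: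

* `abs_levelOne_signedSum_le` — **the level-1 part of a bounded low-degree function is small in sup norm**:
  if `ĝ(S) = 0` for `|S| > d` and `|g| ≤ M` on the cube then `|Σ_i ĝ({i}) χ_i(s)| ≤ d·M` for every sign
  pattern `s`; hence (`levelOne_sum_abs_le`) `Σ_i |ĝ({i})| ≤ d·M`.  Proof: the NOISE POLYNOMIAL
  `P_s(t) = Σ_S t^{|S|} ĝ(S) χ_S(s)` is, for `t ∈ [-1, 1]`, the value at `s` of the noise operator with flip
  probability `(1 - t)/2` applied to `g` (tree: `noiseOp`, `cubeFourierCoeff_noiseOp`), a convex combination of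
  values of `g`, so `|P_s| ≤ M` on `[-1, 1]`; `deg P_s ≤ d`; and `P_s'(0) = Σ_i ĝ({i}) χ_i(s)`.  Bernstein's
  inequality at the interior point `0` (tree: `Literature.Analysis.Approximation.bernstein_inequality`,
  Korneichuk Prop. 3.5.7) gives `|P_s'(0)| ≤ d·M`.
* `exists_influence_ge_levelOne` — for a real polynomial `p` of total degree `≤ d` with `0 ≤ p ≤ 1` on the
  cube (`M = 1/2` after centring) and `N ≥ 1`: some variable has `16·W₁[p]² ≤ d²·Inf_i[p]`, where
  `W₁[p] = Σ_i p̂({i})²` is the level-1 Fourier weight and `Inf_i = E (p - p^{⊕i})² = 4 Σ_{S∋i} p̂(S)²`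
  (`W₁ ≤ maxᵢ|p̂({i})| · Σᵢ|p̂({i})| ≤ maxᵢ|p̂({i})| · d/2`).
* `exists_influence_ge_levelOne_pseudoBounded` — on `K_T` (`d = 2T`): `4·W₁[p]² ≤ T²·Inf_i[p]`;
  `levelOne_share_pseudoBoundedAA` — consequently PB-AA's LITERAL conclusion `C (ε/T)^c ≤ Inf_i[p]` with
  `(c, C) = (2, 4η²)` for every `p ∈ K_T` whose level-1 weight carries a share `η` of the variance
  (`η·Var[p] ≤ W₁[p]`, `Var[p] ≥ ε > 0`) — the card's sharp exponents `(2, 2)`;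
  `exists_influence_ge_levelOne_query` — the same on `Q_T` (acceptance polynomials of `T`-query algorithms).
* `levelOne_rung_tight` — the rung is TIGHT at `d = 1`: for the dictator `p = x₀` on one bit,
  `16·W₁² = 1 = d²·Inf₀`.

What this buys for the crux: with the landed top rungs, for `T = 2` (levels `1…4`) the only Fourier level not
covered by a polynomial-loss rung is level `2`; in general the middle levels `2 … 2T-2` remain — the printed
obstruction (Slote–Volberg–Zhang 2026, §1: a polynomial Bohnenblust–Hille constant on the cube would settle
Aaronson–Ambainis; level `1` is the case where that constant is Bernstein's `d`).

Honest label: a support lemma (new rung, sharp exponents, valid on all bounded low-degree functions); no stub,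
crux or summit is proved.  Sources: Korneichuk 1991 Prop. 3.5.7 (Bernstein); O'Donnell 2014 §2.4 (noise
operator), §2.2 (influences); Aaronson–Ambainis 2014 Conj. 6; arXiv:2608.04411 §1.
-/

-- D-0017: single-conjunct summit ⇒ the duplicate `QuantumAdvantage.QuantumAdvantage` is mandated.
set_option linter.dupNamespace false

noncomputable section

namespace Summit.QuantumAdvantage.QuantumAdvantage.Theorems.SosSandwich.LevelOneRung

open Finset
open Literature.Computability.QuantumComplexity
open Literature.Computability.Complexity.LowDegree (cubeFourierCoeff sum_cubeFourierCoeff_mul_walsh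
  sum_walsh_mul_walsh_index)
open Literature.Probability.RandomGraphs.LowDegree (sgn walsh sgn_true sgn_false walsh_empty)
open Literature.Barriers.QuantumAdvantage (noiseOp flipWeight flipWeight_nonneg sum_flipWeight
  cubeFourierCoeff_noiseOp bxor)
open Literature.Computability.Cryptography (QQueryAlg)

variable {N : ℕ}

/-! ### §1 The noise polynomial `P_s(t) = Σ_S t^{|S|} ĝ(S) χ_S(s)` -/

/-- The noise operator in the Walsh basis, pointwise: `(T_η g)(s) = Σ_S (1 - 2η)^{|S|} ĝ(S) χ_S(s)`.
[cite: ODonnell2014, §2.4 (Prop. 2.47)] -/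
theorem noiseOp_eq_sum_pow (η : ℝ) (g : (Fin N → Bool) → ℝ) (s : Fin N → Bool) :
    noiseOp η g s = ∑ S : Finset (Fin N), (1 - 2 * η) ^ S.card * cubeFourierCoeff g S * walsh S s := by
  rw [← sum_cubeFourierCoeff_mul_walsh (noiseOp η g) s]
  exact Finset.sum_congr rfl fun S _ => by rw [cubeFourierCoeff_noiseOp]

/-- A noisy value is a convex combination of values: `|g| ≤ M` on the cube gives `|(T_η g)(s)| ≤ M` for
`0 ≤ η ≤ 1`. [cite: ODonnell2014, §2.4 (T_ρ is an averaging operator)] -/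
theorem abs_noiseOp_le {η M : ℝ} (h0 : 0 ≤ η) (h1 : η ≤ 1) {g : (Fin N → Bool) → ℝ}
    (hM : ∀ x, |g x| ≤ M) (s : Fin N → Bool) : |noiseOp η g s| ≤ M := by
  unfold noiseOp
  calc |∑ e, flipWeight η e * g (bxor s e)|
      ≤ ∑ e, |flipWeight η e * g (bxor s e)| := Finset.abs_sum_le_sum_abs _ _
    _ ≤ ∑ e, flipWeight η e * M := Finset.sum_le_sum fun e _ => by
        rw [abs_mul, abs_of_nonneg (flipWeight_nonneg h0 h1 e)]
        exact mul_le_mul_of_nonneg_left (hM _) (flipWeight_nonneg h0 h1 e)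
    _ = M := by rw [← Finset.sum_mul, sum_flipWeight, one_mul]

/-- Evaluation of the noise polynomial: `P_s(t) = Σ_S ĝ(S) χ_S(s) t^{|S|}`. [folklore] -/
theorem eval_noisePoly (g : (Fin N → Bool) → ℝ) (s : Fin N → Bool) (t : ℝ) :
    (∑ S : Finset (Fin N), Polynomial.C (cubeFourierCoeff g S * walsh S s) * Polynomial.X ^ S.card).eval t =
      ∑ S : Finset (Fin N), cubeFourierCoeff g S * walsh S s * t ^ S.card := by
  rw [Polynomial.eval_finsetSum]
  exact Finset.sum_congr rfl fun S _ => by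
    rw [Polynomial.eval_mul, Polynomial.eval_C, Polynomial.eval_pow, Polynomial.eval_X]

/-- **The noise polynomial is the noisy value**: `P_s(t) = (T_{(1-t)/2} g)(s)`. [cite: ODonnell2014, §2.4] -/
theorem eval_noisePoly_eq_noiseOp (g : (Fin N → Bool) → ℝ) (s : Fin N → Bool) (t : ℝ) :
    (∑ S : Finset (Fin N), Polynomial.C (cubeFourierCoeff g S * walsh S s) * Polynomial.X ^ S.card).eval t =
      noiseOp ((1 - t) / 2) g s := by
  rw [eval_noisePoly, noiseOp_eq_sum_pow]
  exact Finset.sum_congr rfl fun S _ => by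
    have : (1 - 2 * ((1 - t) / 2)) = t := by ring
    rw [this]; ring

/-- The noise polynomial of an `M`-bounded `g` is bounded by `M` on `[-1, 1]`. [cite: ODonnell2014, §2.4] -/
theorem abs_eval_noisePoly_le {M : ℝ} {g : (Fin N → Bool) → ℝ} (hM : ∀ x, |g x| ≤ M) (s : Fin N → Bool)
    {t : ℝ} (ht : t ∈ Set.Icc (-1 : ℝ) 1) :
    |(∑ S : Finset (Fin N), Polynomial.C (cubeFourierCoeff g S * walsh S s) * Polynomial.X ^ S.card).eval t|
      ≤ M := by
  rw [eval_noisePoly_eq_noiseOp]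
  obtain ⟨h1, h2⟩ := ht
  exact abs_noiseOp_le (by linarith) (by linarith) hM s

/-- The noise polynomial of a function of Fourier degree `≤ d` has degree `≤ d`. [folklore] -/
theorem degree_noisePoly_le {d : ℕ} {g : (Fin N → Bool) → ℝ}
    (hdeg : ∀ S : Finset (Fin N), d < S.card → cubeFourierCoeff g S = 0) (s : Fin N → Bool) :
    (∑ S : Finset (Fin N), Polynomial.C (cubeFourierCoeff g S * walsh S s) * Polynomial.X ^ S.card).degree
      ≤ (d : WithBot ℕ) := by
  refine (Polynomial.degree_sum_le _ _).trans (Finset.sup_le fun S _ => ?_)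
  by_cases hS : d < S.card
  · rw [hdeg S hS, zero_mul, map_zero, zero_mul, Polynomial.degree_zero]
    exact bot_le
  · exact (Polynomial.degree_C_mul_X_pow_le _ _).trans (by exact_mod_cast Nat.le_of_not_lt hS)

/-- Sums over the level-1 sets are sums over variables: `Σ_{|S| = 1} a(S) = Σ_i a({i})`. [folklore] -/
theorem sum_ite_one_eq_card (a : Finset (Fin N) → ℝ) :
    ∑ S : Finset (Fin N), (if 1 = S.card then a S else 0) = ∑ i : Fin N, a {i} := by
  rw [← Finset.sum_filter]
  have h : (Finset.univ.filter fun S : Finset (Fin N) => 1 = S.card) =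
      Finset.univ.map ⟨fun i : Fin N => ({i} : Finset (Fin N)), Finset.singleton_injective⟩ := by
    ext S
    simp only [Finset.mem_filter, Finset.mem_univ, true_and, Finset.mem_map, Function.Embedding.coeFn_mk]
    constructor
    · intro hS
      obtain ⟨i, rfl⟩ := Finset.card_eq_one.mp hS.symm
      exact ⟨i, rfl⟩
    · rintro ⟨i, rfl⟩
      rw [Finset.card_singleton]
  rw [h, Finset.sum_map]
  rfl

/-- The derivative of the noise polynomial at `0` is the signed level-1 sum `Σ_i ĝ({i}) χ_i(s)`. [folklore] -/
theorem eval_zero_derivative_noisePoly (g : (Fin N → Bool) → ℝ) (s : Fin N → Bool) :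
    (Polynomial.derivative (∑ S : Finset (Fin N),
        Polynomial.C (cubeFourierCoeff g S * walsh S s) * Polynomial.X ^ S.card)).eval 0 =
      ∑ i : Fin N, cubeFourierCoeff g {i} * sgn (s i) := by
  rw [← Polynomial.coeff_zero_eq_eval_zero, Polynomial.coeff_derivative, Polynomial.finsetSum_coeff]
  simp only [Nat.cast_zero, zero_add, mul_one, Polynomial.coeff_C_mul_X_pow]
  rw [sum_ite_one_eq_card]
  exact Finset.sum_congr rfl fun i _ => by rw [walsh, Finset.prod_singleton]

/-! ### §2 The level-1 inequality `Σ_i |ĝ({i})| ≤ d·M` -/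

/-- **The level-1 part of a bounded function of Fourier degree `≤ d` is `d·M`-bounded**: for every sign
pattern `s`, `|Σ_i ĝ({i}) χ_i(s)| ≤ d·M` — Bernstein's inequality at the interior point `0` applied to the
noise polynomial `P_s`. [cite: Korneichuk1991, Prop 3.5.7 (§3.5.4)] [cite: ODonnell2014, §2.4] -/
theorem abs_levelOne_signedSum_le {d : ℕ} {M : ℝ} {g : (Fin N → Bool) → ℝ}
    (hdeg : ∀ S : Finset (Fin N), d < S.card → cubeFourierCoeff g S = 0) (hM : ∀ x, |g x| ≤ M)
    (s : Fin N → Bool) : |∑ i : Fin N, cubeFourierCoeff g {i} * sgn (s i)| ≤ d * M := by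
  have h := Literature.Analysis.Approximation.bernstein_inequality (degree_noisePoly_le hdeg s)
    (fun y hy => abs_eval_noisePoly_le hM s hy) (x := 0) ⟨by norm_num, by norm_num⟩
  rw [eval_zero_derivative_noisePoly] at h
  simpa using h

/-- **`Σ_i |ĝ({i})| ≤ d·M`** for an `M`-bounded `g` of Fourier degree `≤ d` (the sign pattern matching the
signs of the level-1 coefficients). [cite: Korneichuk1991, Prop 3.5.7 (§3.5.4)] [cite: ODonnell2014, §2.4] -/
theorem levelOne_sum_abs_le {d : ℕ} {M : ℝ} {g : (Fin N → Bool) → ℝ}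
    (hdeg : ∀ S : Finset (Fin N), d < S.card → cubeFourierCoeff g S = 0) (hM : ∀ x, |g x| ≤ M) :
    ∑ i : Fin N, |cubeFourierCoeff g {i}| ≤ d * M := by
  have h := abs_levelOne_signedSum_le hdeg hM (fun i => decide (cubeFourierCoeff g {i} < 0))
  have hterm : ∀ i : Fin N, cubeFourierCoeff g {i} * sgn (decide (cubeFourierCoeff g {i} < 0)) =
      |cubeFourierCoeff g {i}| := by
    intro i
    by_cases hlt : cubeFourierCoeff g {i} < 0
    · rw [decide_eq_true hlt, sgn_true, abs_of_neg hlt]; ring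
    · rw [decide_eq_false hlt, sgn_false, abs_of_nonneg (not_lt.mp hlt), mul_one]
  simp_rw [hterm] at h
  exact le_trans (le_abs_self _) h

/-! ### §3 The level-one rung: `16·W₁[p]² ≤ d²·maxᵢ Inf_i[p]` for `0 ≤ p ≤ 1` of degree `≤ d` -/

/-- Shifting by a constant does not change the Fourier coefficients at nonempty sets. [cite: ODonnell2014, §1.4] -/
theorem cubeFourierCoeff_sub_const {f : (Fin N → Bool) → ℝ} (c : ℝ) {S : Finset (Fin N)} (hS : S ≠ ∅) :
    cubeFourierCoeff (fun x => f x - c) S = cubeFourierCoeff f S := by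
  unfold cubeFourierCoeff
  have h0 : ∑ x : Fin N → Bool, walsh S x = 0 := by
    have h := sum_walsh_mul_walsh_index S (∅ : Finset (Fin N))
    simp only [walsh_empty, mul_one, if_neg hS] at h
    exact h
  congr 1
  simp_rw [sub_mul, Finset.sum_sub_distrib, ← Finset.mul_sum, h0, mul_zero, sub_zero]

/-- A single level-1 coefficient is dominated by the influence: `4·p̂({i})² ≤ Inf_i[p]`
(`Inf_i = 4 Σ_{S ∋ i} p̂(S)²`). [cite: ODonnell2014, §2.2 (Fourier formula for influences)] -/
theorem four_mul_sq_coeff_le_influence (p : MvPolynomial (Fin N) ℝ) (i : Fin N) :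
    4 * cubeFourierCoeff (evalBool p) {i} ^ 2 ≤ influence i p := by
  rw [influence_eq_sum_sq_fourier]
  refine mul_le_mul_of_nonneg_left ?_ (by norm_num)
  exact Finset.single_le_sum (f := fun S => cubeFourierCoeff (evalBool p) S ^ 2)
    (fun S _ => sq_nonneg _) (by simp)

/-- **`Σ_i |p̂({i})| ≤ d/2`** for a real polynomial of total degree `≤ d` with `0 ≤ p ≤ 1` on the cube
(apply `levelOne_sum_abs_le` to `p - 1/2`, `M = 1/2`). [cite: Korneichuk1991, Prop 3.5.7 (§3.5.4)]
[cite: ODonnell2014, §2.4] -/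
theorem levelOne_sum_abs_le_half {d : ℕ} {p : MvPolynomial (Fin N) ℝ} (hp : p.totalDegree ≤ d)
    (hb : ∀ x, 0 ≤ evalBool p x ∧ evalBool p x ≤ 1) :
    ∑ i : Fin N, |cubeFourierCoeff (evalBool p) {i}| ≤ d * (1 / 2 : ℝ) := by
  have hdeg : ∀ S : Finset (Fin N), d < S.card →
      cubeFourierCoeff (fun x => evalBool p x - 1 / 2) S = 0 := by
    intro S hS
    have hS0 : S ≠ ∅ := by rintro rfl; simp at hS
    rw [cubeFourierCoeff_sub_const _ hS0]
    exact cubeFourierCoeff_evalBool_eq_zero hp hS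
  have hM : ∀ x, |evalBool p x - 1 / 2| ≤ 1 / 2 := fun x => by
    rw [abs_le]; constructor <;> linarith [(hb x).1, (hb x).2]
  have h := levelOne_sum_abs_le hdeg hM
  have hi : ∀ i : Fin N, cubeFourierCoeff (fun x => evalBool p x - 1 / 2) {i} =
      cubeFourierCoeff (evalBool p) {i} := fun i =>
    cubeFourierCoeff_sub_const _ (Finset.singleton_ne_empty i)
  simp_rw [hi] at h
  exact h

/-- **The level-one rung.**  For a real polynomial `p` of total degree `≤ d` with `0 ≤ p ≤ 1` on the cube
`{0,1}^N`, `N ≥ 1`, some variable `i` has `16·W₁[p]² ≤ d²·Inf_i[p]`, where `W₁[p] = Σ_i p̂({i})²` is the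
level-1 Fourier weight (`W₁ ≤ maxᵢ |p̂({i})| · Σᵢ |p̂({i})| ≤ maxᵢ |p̂({i})| · d/2` and
`4 p̂({i})² ≤ Inf_i`). [cite: Korneichuk1991, Prop 3.5.7 (§3.5.4)] [cite: ODonnell2014, §2.2, §2.4]
[cite: AaronsonAmbainis2014, Conj. 6] -/
theorem exists_influence_ge_levelOne {d : ℕ} {p : MvPolynomial (Fin N) ℝ} (hN : 0 < N)
    (hp : p.totalDegree ≤ d) (hb : ∀ x, 0 ≤ evalBool p x ∧ evalBool p x ≤ 1) :
    ∃ i : Fin N, 16 * (∑ j : Fin N, cubeFourierCoeff (evalBool p) {j} ^ 2) ^ 2 ≤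
      (d : ℝ) ^ 2 * influence i p := by
  haveI : Nonempty (Fin N) := Fin.pos_iff_nonempty.mp hN
  obtain ⟨i, -, hi⟩ := Finset.exists_max_image Finset.univ
    (fun j : Fin N => |cubeFourierCoeff (evalBool p) {j}|) Finset.univ_nonempty
  refine ⟨i, ?_⟩
  set a : Fin N → ℝ := fun j => cubeFourierCoeff (evalBool p) {j} with ha
  have hmax : ∀ j, |a j| ≤ |a i| := fun j => hi j (Finset.mem_univ j)
  have hl1 : ∑ j, |a j| ≤ d * (1 / 2 : ℝ) := levelOne_sum_abs_le_half hp hb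
  -- `W₁ ≤ |a i| · Σ_j |a j| ≤ |a i| · d/2`
  have hW : ∑ j, a j ^ 2 ≤ |a i| * (d * (1 / 2 : ℝ)) := by
    calc ∑ j, a j ^ 2 = ∑ j, |a j| * |a j| := Finset.sum_congr rfl fun j _ => by
            rw [← sq, sq_abs]
      _ ≤ ∑ j, |a i| * |a j| :=
            Finset.sum_le_sum fun j _ => mul_le_mul_of_nonneg_right (hmax j) (abs_nonneg _)
      _ = |a i| * ∑ j, |a j| := by rw [Finset.mul_sum]
      _ ≤ |a i| * (d * (1 / 2 : ℝ)) := mul_le_mul_of_nonneg_left hl1 (abs_nonneg _)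
  have hW0 : 0 ≤ ∑ j, a j ^ 2 := Finset.sum_nonneg fun j _ => sq_nonneg _
  have hinf : 4 * a i ^ 2 ≤ influence i p := four_mul_sq_coeff_le_influence p i
  have hsq : (∑ j, a j ^ 2) ^ 2 ≤ (|a i| * (d * (1 / 2 : ℝ))) ^ 2 := pow_le_pow_left₀ hW0 hW 2
  calc 16 * (∑ j, a j ^ 2) ^ 2 ≤ 16 * (|a i| * (d * (1 / 2 : ℝ))) ^ 2 := by linarith
    _ = (d : ℝ) ^ 2 * (4 * a i ^ 2) := by rw [mul_pow, sq_abs]; ring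
    _ ≤ (d : ℝ) ^ 2 * influence i p := mul_le_mul_of_nonneg_left hinf (by positivity)

/-! ### §4 On the SOS sandwich class `K_T` and on `Q_T` -/

/-- **The level-one rung on `K_T`.**  Every pseudo-bounded `p` of order `T` on `N ≥ 1` bits has a variable
with `4·W₁[p]² ≤ T²·Inf_i[p]` (`K_T ∋ p` agrees on the cube with a `[0,1]`-bounded representative of total
degree `≤ 2T`). [cite: KaniewskiLeeDewolf2015, Def. 7] [cite: Korneichuk1991, Prop 3.5.7 (§3.5.4)]
[cite: AaronsonAmbainis2014, Conj. 6] -/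
theorem exists_influence_ge_levelOne_pseudoBounded {T : ℕ} {p : MvPolynomial (Fin N) ℝ} (hN : 0 < N)
    (h : PseudoBounded T p) :
    ∃ i : Fin N, 4 * (∑ j : Fin N, cubeFourierCoeff (evalBool p) {j} ^ 2) ^ 2 ≤
      (T : ℝ) ^ 2 * influence i p := by
  obtain ⟨p', hdeg, hb, heq⟩ := exists_representative_of_pseudoBounded h
  obtain ⟨i, hi⟩ := exists_influence_ge_levelOne hN hdeg hb
  refine ⟨i, ?_⟩
  have hinf : influence i p' = influence i p := by unfold influence; rw [heq]
  rw [heq, hinf] at hi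
  have h4 : ((2 * T : ℕ) : ℝ) ^ 2 * influence i p = 4 * ((T : ℝ) ^ 2 * influence i p) := by
    push_cast; ring
  rw [h4] at hi
  linarith

/-- **PB-AA's literal conclusion on the level-1 share, with the card's sharp exponents `(2, 2)`.**  For every
`η > 0`: if `p ∈ K_T` (`T ≥ 1`) has `Var[p] ≥ ε > 0` and its level-1 Fourier weight carries the share `η` of
the variance (`η·Var[p] ≤ W₁[p]`), then some variable has `4η²·(ε/T)² ≤ Inf_i[p]` — the conclusion
`C (ε/T)^c ≤ Inf_i[p]` of the crux `PseudoBoundedAA` with `(c, C) = (2, 4η²)` (`PseudoBounded`,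
`boolVariance`, `influence` are definitionally the route file's inline `let ev / let avg` vocabulary).
[cite: AaronsonAmbainis2014, Conj. 6] [cite: Korneichuk1991, Prop 3.5.7 (§3.5.4)] -/
theorem levelOne_share_pseudoBoundedAA {η : ℝ} (hη : 0 < η) (N T : ℕ) (p : MvPolynomial (Fin N) ℝ)
    (ε : ℝ) (hT : 1 ≤ T) (h : PseudoBounded T p) (hε : 0 < ε) (hv : ε ≤ boolVariance p)
    (hshare : η * boolVariance p ≤ ∑ j : Fin N, cubeFourierCoeff (evalBool p) {j} ^ 2) :
    ∃ i : Fin N, 4 * η ^ 2 * (ε / T) ^ 2 ≤ influence i p := by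
  rcases Nat.eq_zero_or_pos N with hN0 | hN
  · exfalso
    subst hN0
    have h0 : ∑ j : Fin 0, cubeFourierCoeff (evalBool p) {j} ^ 2 = 0 := by simp
    rw [h0] at hshare
    nlinarith [mul_pos hη (lt_of_lt_of_le hε hv)]
  obtain ⟨i, hi⟩ := exists_influence_ge_levelOne_pseudoBounded hN h
  refine ⟨i, ?_⟩
  have hTpos : (0 : ℝ) < T := by exact_mod_cast hT
  have hW : η * ε ≤ ∑ j : Fin N, cubeFourierCoeff (evalBool p) {j} ^ 2 :=
    le_trans (mul_le_mul_of_nonneg_left hv hη.le) hshare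
  have hW0 : 0 ≤ η * ε := by positivity
  have hsq : (η * ε) ^ 2 ≤ (∑ j : Fin N, cubeFourierCoeff (evalBool p) {j} ^ 2) ^ 2 :=
    pow_le_pow_left₀ hW0 hW 2
  have key : 4 * (η * ε) ^ 2 ≤ (T : ℝ) ^ 2 * influence i p := by linarith
  have hre : 4 * η ^ 2 * (ε / (T : ℝ)) ^ 2 = 4 * (η * ε) ^ 2 / (T : ℝ) ^ 2 := by
    rw [div_pow]; ring
  rw [hre, div_le_iff₀ (by positivity)]
  calc 4 * (η * ε) ^ 2 ≤ (T : ℝ) ^ 2 * influence i p := key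
    _ = influence i p * (T : ℝ) ^ 2 := mul_comm _ _

/-- **The level-one rung on `Q_T`.**  For every quantum algorithm making `T` queries to `N ≥ 1` bits and every
real polynomial `p` with `Q`'s acceptance probabilities as cube values: some variable has
`4·W₁[p]² ≤ T²·Inf_i[p]` (the acceptance polynomial has total degree `≤ 2T` and values in `[0,1]`:
Beals et al. + unitarity, tree `exists_acceptPolynomial`). [cite: BealsEtAl2001, Lemma 4.1]
[cite: Korneichuk1991, Prop 3.5.7 (§3.5.4)] [cite: AaronsonAmbainis2014, Conj. 6] -/
theorem exists_influence_ge_levelOne_query (hN : 0 < N) (Q : QQueryAlg N) (p : MvPolynomial (Fin N) ℝ)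
    (hp : ∀ x, evalBool p x = Q.acceptProb x) :
    ∃ i : Fin N, 4 * (∑ j : Fin N, cubeFourierCoeff (evalBool p) {j} ^ 2) ^ 2 ≤
      (Q.queries : ℝ) ^ 2 * influence i p := by
  obtain ⟨p₀, hdeg, hval⟩ := exists_acceptPolynomial Q
  have heq : evalBool p = evalBool p₀ := funext fun x => by rw [hp x]; exact hval x
  have hb : ∀ x, 0 ≤ evalBool p₀ x ∧ evalBool p₀ x ≤ 1 := fun x => by
    have hx : evalBool p₀ x = Q.acceptProb x := (hval x).symm
    rw [hx]
    exact ⟨Q.acceptProb_nonneg x, Q.acceptProb_le_one' x⟩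
  obtain ⟨i, hi⟩ := exists_influence_ge_levelOne hN hdeg hb
  refine ⟨i, ?_⟩
  have hinf : influence i p = influence i p₀ := by unfold influence; rw [heq]
  rw [heq, hinf]
  have h4 : ((2 * Q.queries : ℕ) : ℝ) ^ 2 * influence i p₀ = 4 * ((Q.queries : ℝ) ^ 2 * influence i p₀) := by
    push_cast; ring
  rw [h4] at hi
  linarith

/-! ### §5 Tightness at `d = 1` -/

/-- The level-1 coefficient of the dictator `x₀` on one bit is `-1/2` (`χ₀(x) = (-1)^{x₀}`). [cite: ODonnell2014, §1.2] -/
theorem cubeFourierCoeff_dictator :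
    cubeFourierCoeff (evalBool (MvPolynomial.X 0 : MvPolynomial (Fin 1) ℝ)) {0} = -1 / 2 := by
  unfold cubeFourierCoeff
  have huniv : (Finset.univ : Finset (Fin 1 → Bool)) = {fun _ => true, fun _ => false} := by
    ext x
    simp only [Finset.mem_univ, Finset.mem_insert, Finset.mem_singleton, true_iff]
    cases hx : x 0
    · right; funext j; rw [Subsingleton.elim j 0, hx]
    · left; funext j; rw [Subsingleton.elim j 0, hx]
  rw [huniv, Finset.sum_pair (by intro h; have := congrFun h 0; simp at this)]
  simp [evalBool, walsh]

/-- **The level-one rung is tight at `d = 1`**: for the dictator `p = x₀` on one bit (total degree `1`,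
`W₁ = 1/4`, `Inf₀ = 1`), `16·W₁² = d²·Inf₀`. [cite: ODonnell2014, §2.2] -/
theorem levelOne_rung_tight :
    16 * (∑ j : Fin 1, cubeFourierCoeff (evalBool (MvPolynomial.X 0 : MvPolynomial (Fin 1) ℝ)) {j} ^ 2) ^ 2 =
      ((1 : ℕ) : ℝ) ^ 2 * influence 0 (MvPolynomial.X 0 : MvPolynomial (Fin 1) ℝ) := by
  rw [Fin.sum_univ_one, cubeFourierCoeff_dictator, influence_dictator 0]
  norm_num

end Summit.QuantumAdvantage.QuantumAdvantage.Theorems.SosSandwich.LevelOneRung
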